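import Summits.KontsevichZagierPeriods.KontsevichZagierPeriods.Theorems.MzvKernelInKZ.Negative.StuffleFour

/-!
# `MzvKernelInKZ` (stmt-KontsevichZagierPeriods-3914): negative side — the six shuffle cells of `Δ₂ × Δ₂` are word representations

Companion of `Negative/StuffleFour.lean`.  The product domain `Δ₂ × Δ₂` of `ζ(2)·ζ(2)` is cut by
the relative order of the coordinates into six open cells (the shuffles of `t₀ > t₁` with
`s₀ > s₁`); each cell, restricted from the product representation (`cellRep`, `IntegralRep.restrict`),
is carried by a coordinate permutation (`IntegralRep.reindex`, one move (2):
`KZ.of_sub_of_reindex_mem_relations`) onto the simplex `Δ₄`, where the product integrand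
`ω₀₁ ⊗ ω₀₁` becomes the word integrand read along the order: cells `A, F ↦ [Δ₄, ω₀₁₀₁]` (`ζ(2,2)`),
cells `B, C, D, E ↦ [Δ₄, ω₀₀₁₁]` (`ζ(3,1)`) — `cellA_equiv`, …, `cellF_equiv`, through the generic
transfer lemma `cellRep_equiv`.  The dissection itself and the shuffle relation are in
`ShuffleFour.lean`.

Sources: M. Eie, *The Theory of Multiple Zeta Values with Applications in Combinatorics* (2013),
§1.2 (shuffle product of iterated integrals); M. Kontsevich, D. Zagier, *Periods* (2001), §1.2.
-/

noncomputable section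

namespace Summit.KontsevichZagierPeriods.MzvKernelInKZ.Negative

open Set MeasureTheory MvPolynomial
open Literature.NumberTheory.Transcendental
open Summit.KontsevichZagierPeriods.KontsevichZagierPeriods.Theses.LinRedNormalForm (MzvKernelInKZ)
open Literature.ModelTheory.ExponentialFields (IsSemialgebraic)

/-! ## The shuffle `ζ(2)² = 2ζ(2,2) + 4ζ(3,1)`: dissection of `Δ₂ × Δ₂` into six cells -/

/-- The word integrand of `0011`, unfolded. [folklore] -/
theorem wordFun_ω31 (t : Fin 4 → ℝ) :
    wordFun ω31 1 t = 1 / t 0 * (1 / t 1) * (1 / (1 - t 2)) * (1 / (1 - t 3)) := by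
  simp [wordFun, ω31, Fin.prod_univ_four]

/-- Membership in `Δ₄`, coordinatewise. [folklore] -/
theorem mem_simplex_four {t : Fin 4 → ℝ} :
    t ∈ simplex 4 ↔ (0 < t 0 ∧ 0 < t 1 ∧ 0 < t 2 ∧ 0 < t 3) ∧ (t 0 < 1 ∧ t 1 < 1 ∧ t 2 < 1 ∧ t 3 < 1) ∧
      (t 1 < t 0 ∧ t 2 < t 1 ∧ t 3 < t 2) := by
  simp only [simplex, mem_setOf_eq, Fin.forall_fin_succ, Fin.strictAnti_iff_succ_lt,
    IsEmpty.forall_iff, and_true]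
  simp

/-- An open cell of the dissection: `P22.domain` cut by three strict inequalities
`z (a 1) < z (a 0)`, `z (a 2) < z (a 1)`, `z (a 3) < z (a 2)` (the chain `z ∘ a` decreasing). [folklore] -/
def cell (a : Fin 4 → Fin 4) : Set (Fin 4 → ℝ) :=
  P22.domain ∩ {z | z (a 1) < z (a 0) ∧ z (a 2) < z (a 1) ∧ z (a 3) < z (a 2)}

/-- Cells lie in `Δ₂ × Δ₂`. [folklore] -/
theorem cell_subset (a : Fin 4 → Fin 4) : cell a ⊆ P22.domain := inter_subset_left

/-- A coordinate half-space `zⱼ < zᵢ` is `ℚ`-semialgebraic. [folklore] -/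
theorem isSemialgebraic_setOf_lt (i j : Fin 4) :
    IsSemialgebraic ℚ {z : Fin 4 → ℝ | z j < z i} := by
  convert Literature.ModelTheory.ExponentialFields.isSemialgebraic_setOf_eval_pos (R := ℝ)
    (X i - X j : MvPolynomial (Fin 4) ℚ) using 1
  ext z
  simp [sub_pos]

/-- Cells are `ℚ`-semialgebraic. [folklore] -/
theorem isSemialgebraic_cell (a : Fin 4 → Fin 4) : IsSemialgebraic ℚ (cell a) := by
  refine P22.isSemialgebraic_domain.inter ?_
  have : {z : Fin 4 → ℝ | z (a 1) < z (a 0) ∧ z (a 2) < z (a 1) ∧ z (a 3) < z (a 2)} =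
      {z | z (a 1) < z (a 0)} ∩ {z | z (a 2) < z (a 1)} ∩ {z | z (a 3) < z (a 2)} := by
    ext z; simp [and_assoc]
  rw [this]
  exact ((isSemialgebraic_setOf_lt _ _).inter (isSemialgebraic_setOf_lt _ _)).inter
    (isSemialgebraic_setOf_lt _ _)

/-- The restriction of the product representation to a cell. [folklore] -/
def cellRep (a : Fin 4 → Fin 4) : KZ.IntegralRep 4 :=
  P22.restrict (cell a) (isSemialgebraic_cell a) (cell_subset a)

/-- **A cell is a word representation up to a coordinate permutation** (generic transfer lemma):
if reindexing by `e` carries the cell onto `Δ₄` and the product integrand onto the word form of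
`ε`, then `[cell, ω⊗ω] ≡ [Δ₄, ω_ε]`. [folklore] -/
theorem cellRep_equiv (a : Fin 4 → Fin 4) (e : Equiv.Perm (Fin 4)) (ε : Fin 4 → Bool) (hε : Adm ε)
    (hdom : {w : Fin 4 → ℝ | (fun i => w (e i)) ∈ cell a} = simplex 4)
    (hint : ∀ w ∈ simplex 4, P22.integrand (fun i => w (e i)) = wordFun ε 1 w) :
    KZ.of (cellRep a) - KZ.of (wordRep ε 1 hε) ∈ KZ.relations := by
  have h1 := KZ.of_sub_of_reindex_mem_relations (cellRep a) e
  have h2 : KZ.of ((cellRep a).reindex e) - KZ.of (wordRep ε 1 hε) ∈ KZ.relations := by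
    refine of_sub_of_mem_relations_of_eqOn ?_ ?_
    · rw [wordRep_domain, KZ.IntegralRep.reindex_domain]
      exact hdom.symm
    · intro w hw
      rw [KZ.IntegralRep.reindex_domain] at hw
      change (fun i => w (e i)) ∈ cell a at hw
      have hw' : w ∈ simplex 4 := by rw [← hdom]; exact hw
      simp only [KZ.IntegralRep.reindex_integrand, wordRep_integrand]
      exact hint w hw'
  have : KZ.of (cellRep a) - KZ.of (wordRep ε 1 hε) =
      (KZ.of (cellRep a) - KZ.of ((cellRep a).reindex e)) +
        (KZ.of ((cellRep a).reindex e) - KZ.of (wordRep ε 1 hε)) := by abel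
  rw [this]
  exact add_mem h1 h2

/-- Membership in a cell, unfolded. [folklore] -/
theorem mem_cell {a : Fin 4 → Fin 4} {z : Fin 4 → ℝ} :
    z ∈ cell a ↔ z ∈ P22.domain ∧ z (a 1) < z (a 0) ∧ z (a 2) < z (a 1) ∧ z (a 3) < z (a 2) :=
  Iff.rfl

/-! ### The six cells -/

/-- The six orders `a` (the coordinates listed decreasingly) and the sorting permutations `e`
(`e i` = position of `zᵢ`), as pairs `(a, e)` with `a ∘ e = id`. [folklore] -/
def aA : Fin 4 → Fin 4 := ![0, 1, 2, 3]
/-- Order `z₀ > z₂ > z₁ > z₃` (word `0011`). [folklore] -/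
def aB : Fin 4 → Fin 4 := ![0, 2, 1, 3]
/-- Order `z₀ > z₂ > z₃ > z₁` (word `0011`). [folklore] -/
def aC : Fin 4 → Fin 4 := ![0, 2, 3, 1]
/-- Order `z₂ > z₀ > z₁ > z₃` (word `0011`). [folklore] -/
def aD : Fin 4 → Fin 4 := ![2, 0, 1, 3]
/-- Order `z₂ > z₀ > z₃ > z₁` (word `0011`). [folklore] -/
def aE : Fin 4 → Fin 4 := ![2, 0, 3, 1]
/-- Order `z₂ > z₃ > z₀ > z₁` (word `0101`). [folklore] -/
def aF : Fin 4 → Fin 4 := ![2, 3, 0, 1]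

/-- Generic: reindexing by the permutation `e` with `w (e i) = zᵢ`, i.e. `z = w ∘ e`, where `a` lists
the coordinates decreasingly and `e = a⁻¹`, carries the cell onto the simplex. We prove it for each
cell by unfolding. [folklore] -/
theorem cell_dom (a : Fin 4 → Fin 4) (e : Equiv.Perm (Fin 4)) (h0 : e (a 0) = 0) (h1 : e (a 1) = 1)
    (h2 : e (a 2) = 2) (h3 : e (a 3) = 3)
    (hP : ∀ w : Fin 4 → ℝ, w ∈ simplex 4 →  (fun i => w (e i)) ∈ P22.domain)
    (hP' : ∀ w : Fin 4 → ℝ, (fun i => w (e i)) ∈ P22.domain →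
      (∀ i, 0 < w i) ∧ (∀ i, w i < 1)) :
    {w : Fin 4 → ℝ | (fun i => w (e i)) ∈ cell a} = simplex 4 := by
  ext w
  simp only [mem_setOf_eq, mem_cell, h0, h1, h2, h3]
  constructor
  · rintro ⟨hP0, c1, c2, c3⟩
    obtain ⟨hp, hl⟩ := hP' w hP0
    refine ⟨hp, hl, ?_⟩
    rw [Fin.strictAnti_iff_succ_lt]
    intro i
    fin_cases i
    · simpa using c1
    · simpa using c2
    · simpa using c3
  · intro hw
    refine ⟨hP w hw, ?_⟩
    obtain ⟨-, -, c1, c2, c3⟩ := mem_simplex_four.mp hw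
    exact ⟨c1, c2, c3⟩

/-- The sorting permutations (`e = a⁻¹`). [folklore] -/
def eA : Equiv.Perm (Fin 4) := Equiv.refl _
/-- Sorting permutation of cell `B`. [folklore] -/
def eB : Equiv.Perm (Fin 4) := ⟨![0, 2, 1, 3], ![0, 2, 1, 3], by decide, by decide⟩
/-- Sorting permutation of cell `C`. [folklore] -/
def eC : Equiv.Perm (Fin 4) := ⟨![0, 3, 1, 2], ![0, 2, 3, 1], by decide, by decide⟩
/-- Sorting permutation of cell `D`. [folklore] -/
def eD : Equiv.Perm (Fin 4) := ⟨![1, 2, 0, 3], ![2, 0, 1, 3], by decide, by decide⟩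
/-- Sorting permutation of cell `E`. [folklore] -/
def eE : Equiv.Perm (Fin 4) := ⟨![1, 3, 0, 2], ![2, 0, 3, 1], by decide, by decide⟩
/-- Sorting permutation of cell `F`. [folklore] -/
def eF : Equiv.Perm (Fin 4) := ⟨![2, 3, 0, 1], ![2, 3, 0, 1], by decide, by decide⟩

/-- Reindexing carries cell `A` onto `Δ₄`. [folklore] -/
theorem dom_A : {w : Fin 4 → ℝ | (fun i => w (eA i)) ∈ cell aA} = simplex 4 := by
  refine cell_dom aA eA (by decide) (by decide) (by decide) (by decide) (fun w hw => ?_) (fun w hw => ?_)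
  · obtain ⟨⟨p0, p1, p2, p3⟩, ⟨l0, l1, l2, l3⟩, c1, c2, c3⟩ := mem_simplex_four.mp hw
    rw [mem_P22_domain]
    simp only [eA, Equiv.refl_apply]
    exact ⟨⟨p0, p1, l0, l1, c1⟩, ⟨p2, p3, l2, l3, c3⟩⟩
  · rw [mem_P22_domain] at hw
    simp only [eA, Equiv.refl_apply] at hw
    obtain ⟨⟨p0, p1, l0, l1, -⟩, ⟨p2, p3, l2, l3, -⟩⟩ := hw
    refine ⟨fun i => ?_, fun i => ?_⟩ <;> fin_cases i <;> assumption

/-- Reindexing carries cell `B` onto `Δ₄`. [folklore] -/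
theorem dom_B : {w : Fin 4 → ℝ | (fun i => w (eB i)) ∈ cell aB} = simplex 4 := by
  refine cell_dom aB eB (by decide) (by decide) (by decide) (by decide) (fun w hw => ?_) (fun w hw => ?_)
  · obtain ⟨⟨p0, p1, p2, p3⟩, ⟨l0, l1, l2, l3⟩, c1, c2, c3⟩ := mem_simplex_four.mp hw
    rw [mem_P22_domain]
    simp [eB]
    exact ⟨⟨p0, p2, l0, l2, by linarith⟩, ⟨p1, p3, l1, l3, by linarith⟩⟩
  · rw [mem_P22_domain] at hw
    simp [eB] at hw
    obtain ⟨⟨p0, p2, l0, l2, -⟩, ⟨p1, p3, l1, l3, -⟩⟩ := hw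
    refine ⟨fun i => ?_, fun i => ?_⟩ <;> fin_cases i <;> assumption

/-- Reindexing carries cell `C` onto `Δ₄`. [folklore] -/
theorem dom_C : {w : Fin 4 → ℝ | (fun i => w (eC i)) ∈ cell aC} = simplex 4 := by
  refine cell_dom aC eC (by decide) (by decide) (by decide) (by decide) (fun w hw => ?_) (fun w hw => ?_)
  · obtain ⟨⟨p0, p1, p2, p3⟩, ⟨l0, l1, l2, l3⟩, c1, c2, c3⟩ := mem_simplex_four.mp hw
    rw [mem_P22_domain]
    simp [eC]
    exact ⟨⟨p0, p3, l0, l3, by linarith⟩, ⟨p1, p2, l1, l2, by linarith⟩⟩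
  · rw [mem_P22_domain] at hw
    simp [eC] at hw
    obtain ⟨⟨p0, p3, l0, l3, -⟩, ⟨p1, p2, l1, l2, -⟩⟩ := hw
    refine ⟨fun i => ?_, fun i => ?_⟩ <;> fin_cases i <;> assumption

/-- Reindexing carries cell `D` onto `Δ₄`. [folklore] -/
theorem dom_D : {w : Fin 4 → ℝ | (fun i => w (eD i)) ∈ cell aD} = simplex 4 := by
  refine cell_dom aD eD (by decide) (by decide) (by decide) (by decide) (fun w hw => ?_) (fun w hw => ?_)
  · obtain ⟨⟨p0, p1, p2, p3⟩, ⟨l0, l1, l2, l3⟩, c1, c2, c3⟩ := mem_simplex_four.mp hw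
    rw [mem_P22_domain]
    simp [eD]
    exact ⟨⟨p1, p2, l1, l2, by linarith⟩, ⟨p0, p3, l0, l3, by linarith⟩⟩
  · rw [mem_P22_domain] at hw
    simp [eD] at hw
    obtain ⟨⟨p1, p2, l1, l2, -⟩, ⟨p0, p3, l0, l3, -⟩⟩ := hw
    refine ⟨fun i => ?_, fun i => ?_⟩ <;> fin_cases i <;> assumption

/-- Reindexing carries cell `E` onto `Δ₄`. [folklore] -/
theorem dom_E : {w : Fin 4 → ℝ | (fun i => w (eE i)) ∈ cell aE} = simplex 4 := by
  refine cell_dom aE eE (by decide) (by decide) (by decide) (by decide) (fun w hw => ?_) (fun w hw => ?_)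
  · obtain ⟨⟨p0, p1, p2, p3⟩, ⟨l0, l1, l2, l3⟩, c1, c2, c3⟩ := mem_simplex_four.mp hw
    rw [mem_P22_domain]
    simp [eE]
    exact ⟨⟨p1, p3, l1, l3, by linarith⟩, ⟨p0, p2, l0, l2, by linarith⟩⟩
  · rw [mem_P22_domain] at hw
    simp [eE] at hw
    obtain ⟨⟨p1, p3, l1, l3, -⟩, ⟨p0, p2, l0, l2, -⟩⟩ := hw
    refine ⟨fun i => ?_, fun i => ?_⟩ <;> fin_cases i <;> assumption

/-- Reindexing carries cell `F` onto `Δ₄`. [folklore] -/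
theorem dom_F : {w : Fin 4 → ℝ | (fun i => w (eF i)) ∈ cell aF} = simplex 4 := by
  refine cell_dom aF eF (by decide) (by decide) (by decide) (by decide) (fun w hw => ?_) (fun w hw => ?_)
  · obtain ⟨⟨p0, p1, p2, p3⟩, ⟨l0, l1, l2, l3⟩, c1, c2, c3⟩ := mem_simplex_four.mp hw
    rw [mem_P22_domain]
    simp [eF]
    exact ⟨⟨p2, p3, l2, l3, by linarith⟩, ⟨p0, p1, l0, l1, by linarith⟩⟩
  · rw [mem_P22_domain] at hw
    simp [eF] at hw
    obtain ⟨⟨p2, p3, l2, l3, -⟩, ⟨p0, p1, l0, l1, -⟩⟩ := hw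
    refine ⟨fun i => ?_, fun i => ?_⟩ <;> fin_cases i <;> assumption

/-- The six cells are word representations: `A, F ≡ [Δ₄, ω₀₁₀₁]`, `B, C, D, E ≡ [Δ₄, ω₀₀₁₁]`. [folklore] -/
theorem cellA_equiv : KZ.of (cellRep aA) - KZ.of (wordRep ω22 1 adm_ω22) ∈ KZ.relations :=
  cellRep_equiv aA eA ω22 adm_ω22 dom_A fun w _ => by
    simp [P22_integrand_apply, wordFun_ω22, eA]; ring

/-- Cell `B` is `[Δ₄, ω₀₀₁₁]` up to a permutation. [folklore] -/
theorem cellB_equiv : KZ.of (cellRep aB) - KZ.of (wordRep ω31 1 adm_ω31) ∈ KZ.relations :=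
  cellRep_equiv aB eB ω31 adm_ω31 dom_B fun w _ => by
    simp [P22_integrand_apply, wordFun_ω31, eB]; ring

/-- Cell `C` is `[Δ₄, ω₀₀₁₁]` up to a permutation. [folklore] -/
theorem cellC_equiv : KZ.of (cellRep aC) - KZ.of (wordRep ω31 1 adm_ω31) ∈ KZ.relations :=
  cellRep_equiv aC eC ω31 adm_ω31 dom_C fun w _ => by
    simp [P22_integrand_apply, wordFun_ω31, eC]; ring

/-- Cell `D` is `[Δ₄, ω₀₀₁₁]` up to a permutation. [folklore] -/
theorem cellD_equiv : KZ.of (cellRep aD) - KZ.of (wordRep ω31 1 adm_ω31) ∈ KZ.relations :=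
  cellRep_equiv aD eD ω31 adm_ω31 dom_D fun w _ => by
    simp [P22_integrand_apply, wordFun_ω31, eD]; ring

/-- Cell `E` is `[Δ₄, ω₀₀₁₁]` up to a permutation. [folklore] -/
theorem cellE_equiv : KZ.of (cellRep aE) - KZ.of (wordRep ω31 1 adm_ω31) ∈ KZ.relations :=
  cellRep_equiv aE eE ω31 adm_ω31 dom_E fun w _ => by
    simp [P22_integrand_apply, wordFun_ω31, eE]; ring

/-- Cell `F` is `[Δ₄, ω₀₁₀₁]` up to a permutation. [folklore] -/
theorem cellF_equiv : KZ.of (cellRep aF) - KZ.of (wordRep ω22 1 adm_ω22) ∈ KZ.relations :=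
  cellRep_equiv aF eF ω22 adm_ω22 dom_F fun w _ => by
    simp [P22_integrand_apply, wordFun_ω22, eF]; ring

end Summit.KontsevichZagierPeriods.MzvKernelInKZ.Negative
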